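import Summits.PneNP.PneNP.Theorems.ClusUniversalCertificatePartitionBookkeeping

/-!
# Route ClusUniversalCertificate, crux `UniversalCertAll` (stmt-PneNP-19683) — UNIFORMLY-MAXIMAL FLAT COVERS certify the inequality

Support file (closes nothing) for the OPEN crux `Summit.PneNP.PneNP.Theses.ClusUniversalCertificate.UniversalCertAll`
(route-PneNP-ClusUniversalCertificate, FRONTIER rung F-N1; registered line `slicing`, open stubs `stub_core` / `stub_iblCore`).
Objects of record: `ClusSkew.projRank`, `ClusSkew.codimY`, `ClusSkew.GoodPiece`, `ClusSkew.pts` and the landed partition bookkeeping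
(`ClusSkew.stub_bookkeeping`, `ClusSkew.piece_bound_avg`, file `ClusUniversalCertificatePartitionBookkeeping`, line `partition` of pnp-ideate-p1).

WHAT IS PROVED (all `n`, `m`):
* `exists_zero_of_projRank_eq` / `projRank_lt_of_far`: a block onto which the direction of a (nonempty) flat `A` projects with full rank
  is met at zero by some point of `A`; hence a FAR block (`0 ∉ π_k(A)`) has `projRank A k < m`.
* `deficit_le_codim` (the card's «always `δ(P) ≤ #far ≤ codim P`»): for a flat `A` and the set `S` of its NEAR blocks,
  `n − Σ_{k∈S} 2^{m − projRank A k} ≤ n·m − dim A.direction` — the single-flat deficit never exceeds the flat's OWN codimension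
  (`dim D ≤ Σ_k rank π_k D` is the landed `ClusSkew.finrank_direction_le_sum_projRank`; far blocks lose a full unit, near blocks are
  paid by `2^{u_k} ≥ 1`).
* `goodPiece_of_uniformlyMax`: a flat `A ⊆ Y` that is a MAXIMUM-dimensional flat of `Y` at EVERY one of its points
  (`n·m − dim A ≤ codim_Y(y)` for all `y ∈ A`, the reverse inequality being automatic) is a good piece (`ClusSkew.GoodPiece`).
* `cert_of_uniformlyMaxPartition`: if `Y` is a disjoint union of such uniformly-maximal flats, the crux's inequality
  `Σ_{y∈Y} (n − codim_Y y) ≤ Σ_k 2^m·#{y ∈ Y : y_k = 0}` holds at `Y` (via `ClusSkew.stub_bookkeeping`).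
* `cert_of_uniformlyMaxCover`: the same from a `q`-FOLD cover (`q ≥ 1`) of `Y` by uniformly-maximal flats with multiplicities — the
  fractional form, which covers e.g. the zero-free products `Π_k (𝔽₂^m ∖ {0})` (covered `2^{m−1}`-fold per block by the affine hyperplanes
  avoiding `0`; these are the TIGHT sets of the crux) and every set on which the maximum flats through distinct points are equal or
  disjoint.

WHY IT MATTERS FOR THE CORE STEP (paper, this seat's lab notes): for a flat `F` that is maximal at each of its points and a block order,
every «fresh» block `j` (conditional projection onto block `j` full) has conditional zero-probability exactly `2^{−m}` under the uniform
measure of `F`, so a uniformly-maximal cover is SELF-FINANCING block by block; the whole difficulty of `stub_core` is the inconsistency of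
maximum flats across points (a flat maximal at `y` but not at `t ∈ F`), i.e. the «load» `ℓ(t) = Σ_{y : t ∈ F_y} 2^{−dim F_y}` exceeding `1`
at hub points.  The pointwise load condition and its `w`-weighted average are FALSE as lemmas (stars of lines; two crossing flats), and the
order-minimised fresh-block count (the cell's JF) is refuted at `(n,m) = (2,3)` (Lines/joint-fullness card) — so this file is the exact
solvable class of that mechanism, not a step of an induction.  FRONTIER rung F-N1; nothing here bears on `P` versus `NP`.
-/

set_option linter.dupNamespace false -- `Summit.PneNP.PneNP.…`: summit = sub-problem name (D-0017 single-conjunct layout)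

namespace Summit.PneNP.PneNP.Theorems.ClusMaxFlatCover

open Finset
open Summit.PneNP.PneNP.Theorems.ClusSkew

variable {n m : ℕ}

/-- If the direction of a nonempty flat `A` projects onto block `k` with full rank `m`, some point of `A` has block `k` equal to `0`. -/
theorem exists_zero_of_projRank_eq (A : AffineSubspace (ZMod 2) (Fin n → Fin m → ZMod 2)) {y : Fin n → Fin m → ZMod 2}
    (hy : y ∈ A) (k : Fin n) (hk : projRank A k = m) : ∃ p ∈ A, p k = 0 := by
  have htop : A.direction.map (LinearMap.proj k : (Fin n → Fin m → ZMod 2) →ₗ[ZMod 2] (Fin m → ZMod 2)) = ⊤ := by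
    apply Submodule.eq_top_of_finrank_eq
    rw [Module.finrank_fintype_fun_eq_card, Fintype.card_fin]
    exact hk
  have hmem : -(y k) ∈ A.direction.map (LinearMap.proj k : (Fin n → Fin m → ZMod 2) →ₗ[ZMod 2] (Fin m → ZMod 2)) := by
    rw [htop]; exact Submodule.mem_top
  obtain ⟨v, hvD, hvk⟩ := Submodule.mem_map.mp hmem
  refine ⟨v +ᵥ y, AffineSubspace.vadd_mem_of_mem_direction hvD hy, ?_⟩
  rw [LinearMap.proj_apply] at hvk
  rw [vadd_eq_add, Pi.add_apply, hvk, neg_add_cancel]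

/-- A FAR block of a nonempty flat (no point of the flat vanishes on it) has projection rank `< m`. -/
theorem projRank_lt_of_far (A : AffineSubspace (ZMod 2) (Fin n → Fin m → ZMod 2)) {y : Fin n → Fin m → ZMod 2}
    (hy : y ∈ A) (k : Fin n) (hfar : ∀ p ∈ A, p k ≠ 0) : projRank A k < m := by
  rcases (projRank_le A k).lt_or_eq with h | h
  · exact h
  · obtain ⟨p, hp, hpk⟩ := exists_zero_of_projRank_eq A hy k h
    exact absurd hpk (hfar p hp)

/-- **The single-flat deficit is at most the flat's own codimension**: with `S` the set of NEAR blocks of a nonempty flat `A`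
(`k ∈ S ↔ ∃ p ∈ A, p_k = 0`), `n − Σ_{k∈S} 2^{m − projRank A k} ≤ n·m − dim A.direction`. -/
theorem deficit_le_codim (A : AffineSubspace (ZMod 2) (Fin n → Fin m → ZMod 2)) {y : Fin n → Fin m → ZMod 2}
    (hy : y ∈ A) (S : Finset (Fin n)) (hS : ∀ k : Fin n, k ∈ S ↔ ∃ p ∈ A, p k = 0) :
    (n : ℤ) - ∑ k ∈ S, (2 : ℤ) ^ (m - projRank A k) ≤ (n : ℤ) * m - (Module.finrank (ZMod 2) A.direction : ℤ) := by
  have hD := finrank_direction_le_sum_projRank A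
  have hr : ∀ k : Fin n, projRank A k ≤ m := projRank_le A
  -- far blocks lose a full unit of rank
  have hfar : ∀ k ∈ Sᶜ, projRank A k + 1 ≤ m := by
    intro k hk
    have hk' : ¬ ∃ p ∈ A, p k = 0 := fun h => (Finset.mem_compl.mp hk) ((hS k).mpr h)
    exact projRank_lt_of_far A hy k (fun p hp hpk => hk' ⟨p, hp, hpk⟩)
  -- near blocks: each bonus is at least one
  have hnear : (S.card : ℤ) ≤ ∑ k ∈ S, (2 : ℤ) ^ (m - projRank A k) := by
    rw [Finset.card_eq_sum_ones]
    push_cast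
    exact Finset.sum_le_sum fun k _ => one_le_pow₀ (by norm_num)
  -- `Σ_k (m − r_k) + Σ_k r_k = n·m`
  have hU : ∑ k : Fin n, (m - projRank A k) + ∑ k : Fin n, projRank A k = n * m := by
    rw [← Finset.sum_add_distrib, Finset.sum_congr rfl fun k _ => Nat.sub_add_cancel (hr k), Finset.sum_const,
      Finset.card_univ, Fintype.card_fin, smul_eq_mul]
  -- the far blocks are at most `Σ_far (m − r_k) ≤ Σ_k (m − r_k)`
  have h1 : Sᶜ.card ≤ ∑ k ∈ Sᶜ, (m - projRank A k) := by
    rw [Finset.card_eq_sum_ones]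
    exact Finset.sum_le_sum fun k hk => by have := hfar k hk; omega
  have h2 : ∑ k ∈ Sᶜ, (m - projRank A k) ≤ ∑ k : Fin n, (m - projRank A k) :=
    Finset.sum_le_sum_of_subset (Finset.subset_univ _)
  have h3 : Sᶜ.card + Module.finrank (ZMod 2) A.direction ≤ n * m := by omega
  have h4 : ((Sᶜ.card + Module.finrank (ZMod 2) A.direction : ℕ) : ℤ) ≤ ((n * m : ℕ) : ℤ) := by exact_mod_cast h3
  push_cast at h4
  have hcard : S.card + Sᶜ.card = n := by
    rw [Finset.card_add_card_compl, Fintype.card_fin]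
  have hcardZ : (S.card : ℤ) + (Sᶜ.card : ℤ) = n := by exact_mod_cast hcard
  linarith

/-- **A uniformly-maximal flat is a good piece.**  If the flat `A ⊆ Y` is nonempty and is a maximum-dimensional flat of `Y` at each of
its points — `n·m − dim A ≤ codim_Y(y)` for every `y ∈ A` — then `A` is a `GoodPiece` (with `S` = all near blocks). -/
theorem goodPiece_of_uniformlyMax (Y : Finset (Fin n → Fin m → ZMod 2)) (A : AffineSubspace (ZMod 2) (Fin n → Fin m → ZMod 2))
    {y₀ : Fin n → Fin m → ZMod 2} (hy₀ : y₀ ∈ A)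
    (hmax : ∀ y ∈ A, (n : ℤ) * m - (Module.finrank (ZMod 2) A.direction : ℤ) ≤ (codimY m Y y : ℤ)) :
    GoodPiece n m Y A := by
  classical
  refine ⟨Finset.univ.filter (fun k : Fin n => ∃ p ∈ A, p k = 0), fun k hk => (Finset.mem_filter.mp hk).2, fun y hy => ?_⟩
  have hS : ∀ k : Fin n, k ∈ Finset.univ.filter (fun k : Fin n => ∃ p ∈ A, p k = 0) ↔ ∃ p ∈ A, p k = 0 := fun k => by
    simp only [Finset.mem_filter, Finset.mem_univ, true_and]
  exact (deficit_le_codim A hy₀ _ hS).trans (hmax y hy)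

/-- **Uniformly-maximal flat partitions certify the crux's inequality.**  If `Y ⊆ (𝔽₂^m)^n` is a disjoint union of flats inside `Y`,
each a maximum-dimensional flat of `Y` at every one of its points, then `Σ_{y∈Y} (n − codim_Y y) ≤ Σ_k 2^m·#{y ∈ Y : y_k = 0}`. -/
theorem cert_of_uniformlyMaxPartition (Y : Finset (Fin n → Fin m → ZMod 2))
    (parts : Finset (AffineSubspace (ZMod 2) (Fin n → Fin m → ZMod 2)))
    (hsub : ∀ A ∈ parts, ∀ z ∈ A, z ∈ Y) (hcov : ∀ y ∈ Y, ∃ A ∈ parts, y ∈ A)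
    (hdisj : ∀ A ∈ parts, ∀ B ∈ parts, A ≠ B → ∀ z ∈ A, z ∉ B)
    (hne : ∀ A ∈ parts, ∃ y, y ∈ A)
    (hmax : ∀ A ∈ parts, ∀ y ∈ A, (n : ℤ) * m - (Module.finrank (ZMod 2) A.direction : ℤ) ≤ (codimY m Y y : ℤ)) :
    ∑ y ∈ Y, ((n : ℤ) - (codimY m Y y : ℤ)) ≤ ∑ k : Fin n, (2 : ℤ) ^ m * ((Y.filter fun y => y k = 0).card : ℤ) :=
  stub_bookkeeping n m Y parts hsub hcov hdisj fun A hA => by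
    obtain ⟨y₀, hy₀⟩ := hne A hA
    exact goodPiece_of_uniformlyMax Y A hy₀ (hmax A hA)

/-- The per-flat bound for a uniformly-maximal flat: `Σ_{y∈A} (n − codim_Y y) ≤ Σ_k 2^m·#{y ∈ A : y_k = 0}`. -/
theorem piece_bound_of_uniformlyMax (Y : Finset (Fin n → Fin m → ZMod 2)) (A : AffineSubspace (ZMod 2) (Fin n → Fin m → ZMod 2))
    (hmax : ∀ y ∈ A, (n : ℤ) * m - (Module.finrank (ZMod 2) A.direction : ℤ) ≤ (codimY m Y y : ℤ)) :
    ∑ y ∈ pts A, ((n : ℤ) - (codimY m Y y : ℤ)) ≤ ∑ k : Fin n, (2 : ℤ) ^ m * (((pts A).filter fun y => y k = 0).card : ℤ) := by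
  classical
  by_cases hne : ∃ y, y ∈ A
  · obtain ⟨y₀, hy₀⟩ := hne
    exact piece_bound_avg Y A (goodPieceAvg_of_goodPiece Y A (goodPiece_of_uniformlyMax Y A hy₀ hmax))
  · have hpts : pts A = ∅ := by
      ext y
      simp only [Finset.notMem_empty, iff_false]
      exact fun hy => hne ⟨y, mem_pts.mp hy⟩
    rw [hpts]
    simp

/-- **Uniformly-maximal flat COVERS certify the crux's inequality (fractional form).**  If the flats of `parts`, taken with
multiplicities `c`, cover every point of `Y` exactly `q ≥ 1` times, lie inside `Y`, and each is a maximum-dimensional flat of `Y` at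
every one of its points, then `Σ_{y∈Y} (n − codim_Y y) ≤ Σ_k 2^m·#{y ∈ Y : y_k = 0}`. -/
theorem cert_of_uniformlyMaxCover (Y : Finset (Fin n → Fin m → ZMod 2))
    (parts : Finset (AffineSubspace (ZMod 2) (Fin n → Fin m → ZMod 2))) (c : AffineSubspace (ZMod 2) (Fin n → Fin m → ZMod 2) → ℕ)
    (q : ℕ) (hq : 0 < q)
    (hsub : ∀ A ∈ parts, ∀ z ∈ A, z ∈ Y)
    (hcov : ∀ y ∈ Y, ∑ A ∈ parts, (if y ∈ pts A then c A else 0) = q)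
    (hmax : ∀ A ∈ parts, ∀ y ∈ A, (n : ℤ) * m - (Module.finrank (ZMod 2) A.direction : ℤ) ≤ (codimY m Y y : ℤ)) :
    ∑ y ∈ Y, ((n : ℤ) - (codimY m Y y : ℤ)) ≤ ∑ k : Fin n, (2 : ℤ) ^ m * ((Y.filter fun y => y k = 0).card : ℤ) := by
  classical
  -- abbreviations
  set f : (Fin n → Fin m → ZMod 2) → ℤ := fun y => (n : ℤ) - (codimY m Y y : ℤ) with hf
  -- the points of a part inside `Y` are exactly `pts A`
  have hptsY : ∀ A ∈ parts, Y.filter (fun y => y ∈ pts A) = pts A := by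
    intro A hA
    ext y
    simp only [Finset.mem_filter]
    constructor
    · exact fun h => h.2
    · exact fun h => ⟨hsub A hA y (mem_pts.mp h), h⟩
  -- (1) `q · Σ_Y f = Σ_A c_A Σ_{pts A} f`
  have hL : (q : ℤ) * ∑ y ∈ Y, f y = ∑ A ∈ parts, (c A : ℤ) * ∑ y ∈ pts A, f y := by
    calc (q : ℤ) * ∑ y ∈ Y, f y = ∑ y ∈ Y, (q : ℤ) * f y := by rw [Finset.mul_sum]
      _ = ∑ y ∈ Y, ∑ A ∈ parts, (if y ∈ pts A then (c A : ℤ) else 0) * f y := by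
          refine Finset.sum_congr rfl fun y hy => ?_
          rw [← Finset.sum_mul]
          congr 1
          have h := hcov y hy
          have h' : ((∑ A ∈ parts, (if y ∈ pts A then c A else 0) : ℕ) : ℤ) = (q : ℤ) := by exact_mod_cast h
          rw [← h']
          push_cast
          exact Finset.sum_congr rfl fun A _ => by split_ifs <;> simp
      _ = ∑ A ∈ parts, ∑ y ∈ Y, (if y ∈ pts A then (c A : ℤ) else 0) * f y := Finset.sum_comm
      _ = ∑ A ∈ parts, (c A : ℤ) * ∑ y ∈ pts A, f y := by
          refine Finset.sum_congr rfl fun A hA => ?_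
          rw [Finset.mul_sum,
            show (∑ y ∈ pts A, (c A : ℤ) * f y) = ∑ y ∈ Y.filter (fun y => y ∈ pts A), (c A : ℤ) * f y by
              rw [hptsY A hA],
            Finset.sum_filter]
          exact Finset.sum_congr rfl fun y _ => by split_ifs <;> simp
  -- (2) `Σ_A c_A Σ_k 2^m #{pts A, k-zero} = q · Σ_k 2^m Z_k`
  have hR : ∑ A ∈ parts, (c A : ℤ) * ∑ k : Fin n, (2 : ℤ) ^ m * (((pts A).filter fun y => y k = 0).card : ℤ) =
      (q : ℤ) * ∑ k : Fin n, (2 : ℤ) ^ m * ((Y.filter fun y => y k = 0).card : ℤ) := by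
    have hcardA : ∀ A ∈ parts, ∀ k : Fin n,
        (((pts A).filter fun y => y k = 0).card : ℤ) = ∑ y ∈ Y.filter (fun y => y k = 0), (if y ∈ pts A then (1 : ℤ) else 0) := by
      intro A hA k
      rw [Finset.sum_ite_mem, Finset.sum_const, nsmul_eq_mul, mul_one]
      congr 2
      ext y
      simp only [Finset.mem_filter, Finset.mem_inter]
      constructor
      · rintro ⟨hyA, hk⟩; exact ⟨⟨hsub A hA y (mem_pts.mp hyA), hk⟩, hyA⟩
      · rintro ⟨⟨_, hk⟩, hyA⟩; exact ⟨hyA, hk⟩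
    have hZ : ∀ k : Fin n, (q : ℤ) * ((Y.filter fun y => y k = 0).card : ℤ) =
        ∑ A ∈ parts, (c A : ℤ) * (((pts A).filter fun y => y k = 0).card : ℤ) := by
      intro k
      calc (q : ℤ) * ((Y.filter fun y => y k = 0).card : ℤ) = ∑ y ∈ Y.filter (fun y => y k = 0), (q : ℤ) := by
            rw [Finset.sum_const, nsmul_eq_mul, mul_comm]
        _ = ∑ y ∈ Y.filter (fun y => y k = 0), ∑ A ∈ parts, (if y ∈ pts A then (c A : ℤ) else 0) := by
            refine Finset.sum_congr rfl fun y hy => ?_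
            have hyY : y ∈ Y := (Finset.mem_filter.mp hy).1
            have h := hcov y hyY
            have h' : ((∑ A ∈ parts, (if y ∈ pts A then c A else 0) : ℕ) : ℤ) = (q : ℤ) := by exact_mod_cast h
            rw [← h']
            push_cast
            exact Finset.sum_congr rfl fun A _ => by split_ifs <;> simp
        _ = ∑ A ∈ parts, ∑ y ∈ Y.filter (fun y => y k = 0), (if y ∈ pts A then (c A : ℤ) else 0) := Finset.sum_comm
        _ = ∑ A ∈ parts, (c A : ℤ) * (((pts A).filter fun y => y k = 0).card : ℤ) := by
            refine Finset.sum_congr rfl fun A hA => ?_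
            rw [hcardA A hA k, Finset.mul_sum]
            exact Finset.sum_congr rfl fun y _ => by split_ifs <;> simp
    rw [Finset.mul_sum]
    calc ∑ A ∈ parts, (c A : ℤ) * ∑ k : Fin n, (2 : ℤ) ^ m * (((pts A).filter fun y => y k = 0).card : ℤ)
        = ∑ A ∈ parts, ∑ k : Fin n, (2 : ℤ) ^ m * ((c A : ℤ) * (((pts A).filter fun y => y k = 0).card : ℤ)) := by
          refine Finset.sum_congr rfl fun A _ => ?_
          rw [Finset.mul_sum]
          exact Finset.sum_congr rfl fun k _ => by ring
      _ = ∑ k : Fin n, ∑ A ∈ parts, (2 : ℤ) ^ m * ((c A : ℤ) * (((pts A).filter fun y => y k = 0).card : ℤ)) := Finset.sum_comm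
      _ = ∑ k : Fin n, (q : ℤ) * ((2 : ℤ) ^ m * ((Y.filter fun y => y k = 0).card : ℤ)) := by
          refine Finset.sum_congr rfl fun k _ => ?_
          rw [← Finset.mul_sum, ← hZ k]
          ring
  -- (3) per-part bounds, weighted by `c_A ≥ 0`
  have hmid : ∑ A ∈ parts, (c A : ℤ) * ∑ y ∈ pts A, f y ≤
      ∑ A ∈ parts, (c A : ℤ) * ∑ k : Fin n, (2 : ℤ) ^ m * (((pts A).filter fun y => y k = 0).card : ℤ) :=
    Finset.sum_le_sum fun A hA =>
      mul_le_mul_of_nonneg_left (piece_bound_of_uniformlyMax Y A (hmax A hA)) (by positivity)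
  have hfin : (q : ℤ) * ∑ y ∈ Y, f y ≤ (q : ℤ) * ∑ k : Fin n, (2 : ℤ) ^ m * ((Y.filter fun y => y k = 0).card : ℤ) := by
    rw [hL, ← hR]; exact hmid
  have hqZ : (0 : ℤ) < (q : ℤ) := by exact_mod_cast hq
  exact le_of_mul_le_mul_left hfin hqZ

end Summit.PneNP.PneNP.Theorems.ClusMaxFlatCover
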